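import Summits.HodgeConjecture.HodgeConjecture.Theorems.VHCAbelianSchemesRoadBoxResolutionsE2
import Literature.AlgebraicGeometry.AbelianVarieties.MarkmanPhiDescentTwistBoxBridge
import HarnessLib

/-!
# Road №4 (`VHCAbelianSchemesRoad`), crux stmt-HodgeConjecture-26512 `DiagLocalOfMarkmanPinnedForall` — route «2T»: the `e₁`-ISOMORPHISM of
# SOCKET v2 TOGETHER WITH its `e₂`, at the SAME `K`, for `Φ := Φ_T`, on the family `p = (a, α′)`, `a^{2s}·φ_Θ⁻¹(α′)^{j} = 1` (`a ∈ J(ℂ)` FREE)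

research route conditional on HC_CM; not a corollary; Q11.4-sentence-2 already refuted in dim ≥ 3.

Seat core-w5 g12 (claim-free; `--supports stmt-HodgeConjecture-26512 --as helper`; 0 new facts; director-hodge g22 R19.143 ∕ R19.153, g23 R19.155:
«the ONLY next object is the E1 ASSEMBLER», design «(ii)+α′» of the E1 scoping memo (core-w5 g11) as priced by LEAD 169 (P3) — rows Φ-(iii) + Φ-(iv) = (v′) + (★)).
Socket v2 (`Theorems/VHCAbelianSchemesRoadOneNonJumpingPointOfBoxIsosPlus.oneNonJumpingPoint_of_boxIsos_pairwiseFullPlus`) binds, for ONE shift-commuting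
`Φ : D⁺(Mod_{A×B}) ⥤ D⁺(Mod_P)` and ONE complex downstairs, the two isomorphisms `e₂ : ι(Φ X₂) ≅ Q(q^*E)` and `e₁ : ι(Φ X₁) ≅ Q(t_p^*q^*E)` at the box objects
`Xᵢ = ⟨Q(A.boxTensorComplex B Rᵢ.P Sᵢ.P), plus_Q_boxTensorComplex A B Rᵢ Sᵢ⟩`. E2 (`Theorems/VHCAbelianSchemesRoadBoxResolutionsE2.e₂_of_boxResolutions`) delivers
`∃ K, e₂` for `Φ_T = markmanPhiDescentTwistPlus J …` at `R₂ = 𝒪(Θ) ⊗ π₁^*R₀₁`, `S₂ = 𝒪(Θ) ⊗ π₂^*R₀₂`. THIS FILE delivers `e₁` AT THE SAME `K`: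

* **`SecantQuotientDatum.e₁e₂_of_boxResolutions`** — under exactly E2's hypotheses ([GS] `Grothendieck_higherDirectImage_coh` + [SP] `ThomasonTrobaugh_vbModel_of_boundedCoh`,
  the numerology `2j+1 = d+1`, `(d+1)m₁ = 2s+j+1`, `(d+1)m₂ + j = 2s`, resolutions `R₀ᵢ` of `F₀ᵢ` on `J∕Gᵢ`, `F₀₂` coherent): `∃ K` bounded VB complex on `Y` with
  `e₂` (E2's conclusion verbatim) AND, for EVERY point `p = (a, α′)` of `P = J × Ĵ` and `x ∈ J(ℂ)` with **(E1) `a^{2s} · β^{j} = 1`**, **(E2) `a^{j} · β^{2s+1} = x`**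
  (`β := φ_Θ⁻¹(α′)`, multiplicatively on `J(ℂ)`), the socket's `e₁` VERBATIM at `R₁ := (R₂.pullbackIso t_x).pullbackIso t_a` (a resolution of `t_a^*t_x^*G₂`) and
  `S₁ := (S₂.pullbackIso t_x).twist P_{α′}^∨` (a resolution of `H₁ = P_{α′}^∨ ⊗ t_x^*H₂`): `ι(Φ_T ⟨Q(J.boxTensorComplex J R₁.P S₁.P), plus_Q_boxTensorComplex J J R₁ S₁⟩) ≅
  Q(translationPullbackComplex D.P p (quotientPullbackComplex D K))` — Literature `MarkmanPhiDescentTwistBoxBridge.markmanPhiDescentTwist_boxIso_translate` fed with E2's `e₂`;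
* **`SecantQuotientDatum.exists_prodPoint_cancel`** — the family is non-empty over EVERY `a ∈ J(ℂ)`: `∃ p`, `p ≫ p₁ = a` ∧ (E1) (`j = d∕2 ≥ 2`, `[j]` onto on `J(ℂ)`);
  with `x := a^{j}β^{2s+1}` (E2) is then `rfl`. In Pic⁰ coordinates (E1) is the A-part `j·α′ = −2s·φ_Θ(a)` and (E2) the Â-part of the cancellation
  `t_p^*[p_Ĵ^*((P̂_{x⁻¹})^∨)] = [N′_p]` (Literature `MarkmanDescentTwistProdTranslateCancel`).

The currency is the socket's verbatim (`HasDerivedCategory.standard`, `D.P`, `D.Y`, `quotientPullbackComplex`, `translationPullbackComplex`, `plus_Q_boxTensorComplex`,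
`J.boxTensorComplex J`; all identifications with the Literature layer's `A.X ⊗ Â.X`, `boxTensorComplex (fst _ _).left (snd _ _).left`, `(prodTranslationSchemeIso J Ĵ p).hom^*•`
are `rfl`). CONDITIONAL on exactly [GS] + [SP] (hypotheses; the (m) MODEL, inherited from E2) and on NOTHING ELSE.

COSTUME: a HELPER toward the `e₁`∕`e₂` binders of socket v2; STATUS-only; no stub is stated, restated or weakened; nothing touches `closes`, the skeleton, any stub,
`PinnedTwistedDatum`, (vi) ∕ [R-VI] or the pairwise-fullness binder `hΦ`. NOTHING here says (N-U♭), (N-U), (m) unconditionally, (π), the crux, №4, HC_AV, HC_CM or HC holds;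
HC_CM HELD, by name only; helper lane (width 0).
References: [cite: Markman2025SecantWeil, §9.3 p. 70 L35–47, p. 71 L46–69, Rem. 9.3.7 (p. 73), Lemma 9.3.3 and 9.3.5] [cite: Mukai1981, §3 (3.1) and Thm. 2.2]
[cite: StacksProject, Tag 0FXX and Tag 0FXZ] [cite: Weibel1994, 10.5.2] [cite: GortzWedhorn2023, Prop. 27.186–27.187].
-/

noncomputable section

-- `TopCat.Presheaf`/`Scheme.Modules` are not reducible (as in Mathlib's `AlgebraicGeometry/Modules/Sheaf.lean`).
set_option backward.isDefEq.respectTransparency false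

open CategoryTheory CategoryTheory.Limits AlgebraicGeometry Opposite MonoidalCategory CartesianMonoidalCategory
open AlgebraicGeometry.Scheme.Modules

namespace Summit.HodgeConjecture.HodgeConjecture.Ring2.SemiregularRepresentatives

set_option linter.dupNamespace false -- the cell's namespace repeats the summit name, as in every `Ring2*` file

namespace SecantQuotientDatum

open Literature.AlgebraicGeometry Literature.AlgebraicGeometry.Motives Literature.AlgebraicGeometry.Motives.AbelianVariety
open Literature.AlgebraicGeometry.Modules Literature.AlgebraicGeometry.KTheory Literature.AlgebraicGeometry.AbelianVarieties
open Literature.AlgebraicGeometry.Morphisms Literature.AlgebraicGeometry.Markman2025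
open Summit.HodgeConjecture.HodgeConjecture.Ring2.SemiregularRepresentatives.NowhereDisplaceable (quotientPullbackComplex plus_Q_boxTensorComplex)

/-- **The `e₁`- AND `e₂`-isomorphisms of socket v2 for `Φ := Φ_T` AT THE SAME complex `K`, placement P1, inputs `F₀ := F₀₁ ⊠ F₀₂`** — CONDITIONAL on [GS]+[SP] only:
for `D : SecantQuotientDatum`, exponents `2j+1 = d+1`, `(d+1)m₁ = 2s+j+1`, `(d+1)m₂ + j = 2s`, modules `F₀ᵢ` on `J∕Gᵢ` with strictly perfect resolutions `R₀ᵢ`, `F₀₂`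
coherent, and `R₂ := 𝒪(Θ) ⊗ π₁^*R₀₁`, `S₂ := 𝒪(Θ) ⊗ π₂^*R₀₂` (`thetaPullbackResolution`): there is a bounded complex `K` of finite locally free `𝒪_Y`-modules with
(`e₂`) `ι(Φ_T ⟨Q(R₂• ⊠ S₂•), _⟩) ≅ Q(q^*K)` AND, for every complex point `p = (a, α′)` of `P = J × Ĵ` and every `x ∈ J(ℂ)` satisfying (E1) `a^{2s}·φ_Θ⁻¹(α′)^{j} = 1` and
(E2) `a^{j}·φ_Θ⁻¹(α′)^{2s+1} = x`, (`e₁`) `ι(Φ_T ⟨Q(R₁• ⊠ S₁•), _⟩) ≅ Q(t_p^*q^*K)` with `R₁ = (R₂.pullbackIso t_x).pullbackIso t_a`, `S₁ = (S₂.pullbackIso t_x).twist P_{α′}^∨`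
— both lines in socket v2's literal currency. Proof: E2's `e₂_of_boxResolutions` gives `K` and `e₂`; the Literature manufacture `markmanPhiDescentTwist_boxIso_translate`
(ROW Φ-(iii) + ROW Φ-(iv) + (★) with the cancellation `t_p^*[T_x] = [N′_p]`) turns that `e₂` into `e₁`, at `𝓔 := quotientPullbackComplex D K`.
[cite: Markman2025SecantWeil, §9.3 p. 71 L46–69 and Rem. 9.3.7 (p. 73)] [cite: Mukai1981, §3 (3.1) p. 158] [cite: Weibel1994, 10.5.2] -/
theorem e₁e₂_of_boxResolutions (hGS : Grothendieck_higherDirectImage_coh.{0, 1, 1}) (hSP : ThomasonTrobaugh_vbModel_of_boundedCoh.{1})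
    (D : SecantQuotientDatum) {s j m₁ m₂ : ℕ} (hj : 2 * j + 1 = D.d + 1) (hm₁ : (D.d + 1) * m₁ = 2 * s + j + 1)
    (hm₂ : (D.d + 1) * m₂ + j = 2 * s)
    {F₀₁ : (D.𝒥.J.torsionQuot D.succ_ne_zero D.G₁ D.G₁_le).X.left.Modules} {F₀₂ : (D.𝒥.J.torsionQuot D.succ_ne_zero D.G₂ D.G₂_le).X.left.Modules}
    (R₀₁ : StrictlyPerfectResolution F₀₁) (R₀₂ : StrictlyPerfectResolution F₀₂) (hF₀₂ : Coh F₀₂) :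
    letI := HasDerivedCategory.standard (D.𝒥.J.prod D.𝒥.J).X.left.Modules
    letI := HasDerivedCategory.standard D.P.X.left.Modules
    -- the `⊗`-spellings of the Literature layer (definitionally equal; instance search does not unfold `prod` ∕ `P`)
    letI := HasDerivedCategory.standard (D.𝒥.J.X ⊗ D.𝒥.J.X).left.Modules
    letI := HasDerivedCategory.standard (D.𝒥.J.X ⊗ (D.𝒥.J.dualOf D.Θ D.isAmple).X).left.Modules
    letI := HasDerivedCategory.standard ((D.𝒥.J.X ⊗ D.𝒥.J.X) ⊗ (D.𝒥.J.dualOf D.Θ D.isAmple).X).left.Modules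
    letI := HasDerivedCategory.standard
      ((secantQuotient D.𝒥.J D.isAmple D.G₁ D.G₂ D.succ_ne_zero D.G₁_le D.G₂_le).X ⊗ D.𝒥.J.X).left.Modules
    letI := HasDerivedCategory.standard (secantQuotient D.𝒥.J D.isAmple D.G₁ D.G₂ D.succ_ne_zero D.G₁_le D.G₂_le).X.left.Modules
    ∃ (K : CochainComplex D.Y.X.left.Modules ℤ) (_ : IsBoundedVBComplex K),
      Nonempty (DerivedCategory.Plus.ι.obj ((markmanPhiDescentTwistPlus D.𝒥.J D.isAmple D.KTheta_eq_bot s j).obj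
          ⟨DerivedCategory.Q.obj (D.𝒥.J.boxTensorComplex D.𝒥.J (thetaPullbackResolution D.𝒥.J D.Θ D.succ_ne_zero D.G₁_le R₀₁).P
              (thetaPullbackResolution D.𝒥.J D.Θ D.succ_ne_zero D.G₂_le R₀₂).P),
            plus_Q_boxTensorComplex D.𝒥.J D.𝒥.J (thetaPullbackResolution D.𝒥.J D.Θ D.succ_ne_zero D.G₁_le R₀₁)
              (thetaPullbackResolution D.𝒥.J D.Θ D.succ_ne_zero D.G₂_le R₀₂)⟩) ≅
        DerivedCategory.Q.obj (quotientPullbackComplex D K)) ∧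
      ∀ (p : D.P.Points ℂ) (x : D.𝒥.J.Points ℂ)
        (_ : (p ≫ fst D.𝒥.J.X (D.𝒥.J.dualOf D.Θ D.isAmple).X) ^ (2 * s) *
            ((p ≫ snd D.𝒥.J.X (D.𝒥.J.dualOf D.Θ D.isAmple).X) ≫ phiThetaInv D.𝒥.J D.isAmple D.KTheta_eq_bot) ^ j = 1)
        (_ : (p ≫ fst D.𝒥.J.X (D.𝒥.J.dualOf D.Θ D.isAmple).X) ^ j *
            ((p ≫ snd D.𝒥.J.X (D.𝒥.J.dualOf D.Θ D.isAmple).X) ≫ phiThetaInv D.𝒥.J D.isAmple D.KTheta_eq_bot) ^ (2 * s + 1) = x),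
        Nonempty (DerivedCategory.Plus.ι.obj ((markmanPhiDescentTwistPlus D.𝒥.J D.isAmple D.KTheta_eq_bot s j).obj
            ⟨DerivedCategory.Q.obj (D.𝒥.J.boxTensorComplex D.𝒥.J
                (((thetaPullbackResolution D.𝒥.J D.Θ D.succ_ne_zero D.G₁_le R₀₁).pullbackIso (translationSchemeIso D.𝒥.J x)).pullbackIso
                  (translationSchemeIso D.𝒥.J (p ≫ fst D.𝒥.J.X (D.𝒥.J.dualOf D.Θ D.isAmple).X))).P
                (((thetaPullbackResolution D.𝒥.J D.Θ D.succ_ne_zero D.G₂_le R₀₂).pullbackIso (translationSchemeIso D.𝒥.J x)).twist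
                  (isFiniteLocallyFree_dual (isFiniteLocallyFree_linePt D.𝒥.J D.isAmple D.KTheta_eq_bot
                    (p ≫ snd D.𝒥.J.X (D.𝒥.J.dualOf D.Θ D.isAmple).X)))
                  (isInvertibleModule_of_hasRank_one
                    (isFiniteLocallyFree_dual (isFiniteLocallyFree_linePt D.𝒥.J D.isAmple D.KTheta_eq_bot
                      (p ≫ snd D.𝒥.J.X (D.𝒥.J.dualOf D.Θ D.isAmple).X)))
                    (hasRank_dual (hasRank_linePt D.𝒥.J D.isAmple D.KTheta_eq_bot
                      (p ≫ snd D.𝒥.J.X (D.𝒥.J.dualOf D.Θ D.isAmple).X))))).P),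
              plus_Q_boxTensorComplex D.𝒥.J D.𝒥.J
                (((thetaPullbackResolution D.𝒥.J D.Θ D.succ_ne_zero D.G₁_le R₀₁).pullbackIso (translationSchemeIso D.𝒥.J x)).pullbackIso
                  (translationSchemeIso D.𝒥.J (p ≫ fst D.𝒥.J.X (D.𝒥.J.dualOf D.Θ D.isAmple).X)))
                (((thetaPullbackResolution D.𝒥.J D.Θ D.succ_ne_zero D.G₂_le R₀₂).pullbackIso (translationSchemeIso D.𝒥.J x)).twist
                  (isFiniteLocallyFree_dual (isFiniteLocallyFree_linePt D.𝒥.J D.isAmple D.KTheta_eq_bot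
                    (p ≫ snd D.𝒥.J.X (D.𝒥.J.dualOf D.Θ D.isAmple).X)))
                  (isInvertibleModule_of_hasRank_one
                    (isFiniteLocallyFree_dual (isFiniteLocallyFree_linePt D.𝒥.J D.isAmple D.KTheta_eq_bot
                      (p ≫ snd D.𝒥.J.X (D.𝒥.J.dualOf D.Θ D.isAmple).X)))
                    (hasRank_dual (hasRank_linePt D.𝒥.J D.isAmple D.KTheta_eq_bot
                      (p ≫ snd D.𝒥.J.X (D.𝒥.J.dualOf D.Θ D.isAmple).X)))))⟩) ≅
          DerivedCategory.Q.obj (translationPullbackComplex D.P p (quotientPullbackComplex D K))) := by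
  -- the statement's instances, re-bound for instance search inside the proof
  letI := HasDerivedCategory.standard (D.𝒥.J.X ⊗ D.𝒥.J.X).left.Modules
  letI := HasDerivedCategory.standard (D.𝒥.J.X ⊗ (D.𝒥.J.dualOf D.Θ D.isAmple).X).left.Modules
  letI := HasDerivedCategory.standard ((D.𝒥.J.X ⊗ D.𝒥.J.X) ⊗ (D.𝒥.J.dualOf D.Θ D.isAmple).X).left.Modules
  letI := HasDerivedCategory.standard
    ((secantQuotient D.𝒥.J D.isAmple D.G₁ D.G₂ D.succ_ne_zero D.G₁_le D.G₂_le).X ⊗ D.𝒥.J.X).left.Modules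
  letI := HasDerivedCategory.standard (secantQuotient D.𝒥.J D.isAmple D.G₁ D.G₂ D.succ_ne_zero D.G₁_le D.G₂_le).X.left.Modules
  obtain ⟨K, hKvb, ⟨e₂⟩⟩ := e₂_of_boxResolutions hGS hSP D hj hm₁ hm₂ R₀₁ R₀₂ hF₀₂
  exact ⟨K, hKvb, ⟨e₂⟩, fun p x h₁ h₂ =>
    ⟨markmanPhiDescentTwist_boxIso_translate D.𝒥.J D.isAmple D.KTheta_eq_bot s j p x h₁ h₂
      (thetaPullbackResolution D.𝒥.J D.Θ D.succ_ne_zero D.G₁_le R₀₁) (thetaPullbackResolution D.𝒥.J D.Θ D.succ_ne_zero D.G₂_le R₀₂)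
      (quotientPullbackComplex D K) _ _ e₂⟩⟩

/-- **The family is non-empty over every `a ∈ J(ℂ)`**: for a secant–quotient datum with `2j+1 = d+1` (so `j = d∕2 ≥ 2`) and every complex point `a` of `J` there is a
point `p = (a, φ_Θ(β))` of `P = J × Ĵ` with `p ≫ p₁ = a` and (E1) `a^{2s} · (φ_Θ(β) ≫ φ_Θ⁻¹)^{j} = 1` (`β^{j} = a^{−2s}` is solvable since `[j]` is onto on `J(ℂ)`;
Literature `exists_prodPoint_cancel`); (E2) then DEFINES `x := a^{j}·β^{2s+1}`. So in `e₁e₂_of_boxResolutions` the `J`-coordinate of `p` is FREE.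
[cite: GortzWedhorn2023, Prop. 27.186 and Prop. 27.187] [cite: MumfordAV1970, §6 App. 3 and §7] -/
theorem exists_prodPoint_cancel (D : SecantQuotientDatum) {s j : ℕ} (hj : 2 * j + 1 = D.d + 1) (a : D.𝒥.J.Points ℂ) :
    ∃ p : D.P.Points ℂ, p ≫ fst D.𝒥.J.X (D.𝒥.J.dualOf D.Θ D.isAmple).X = a ∧
      (p ≫ fst D.𝒥.J.X (D.𝒥.J.dualOf D.Θ D.isAmple).X) ^ (2 * s) *
        ((p ≫ snd D.𝒥.J.X (D.𝒥.J.dualOf D.Θ D.isAmple).X) ≫ phiThetaInv D.𝒥.J D.isAmple D.KTheta_eq_bot) ^ j = 1 := by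
  have hj0 : j ≠ 0 := by
    have := D.four_le
    omega
  exact Literature.AlgebraicGeometry.AbelianVarieties.exists_prodPoint_cancel D.𝒥.J D.isAmple D.KTheta_eq_bot s j hj0 a

end SecantQuotientDatum

end Summit.HodgeConjecture.HodgeConjecture.Ring2.SemiregularRepresentatives

end
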